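import Literature.MathematicalPhysics.QuantumFieldTheory.Balaban1983to89.HaarExponentialChartMeasure
import Literature.RepresentationTheory.CompactGroups.MatrixGroupExpSurjective

/-!
# `Balaban1983to89.ExpSurjectiveConnectedSubgroup` — [BrockerTomDieck1985] IV (2.2) «THE EXPONENTIAL MAP OF A COMPACT
# CONNECTED LIE GROUP IS SURJECTIVE» FOR EVERY CLOSED CONNECTED `G ≤ U(N)` IN THE LINEAGE'S CHART LANGUAGE:
# every `u ∈ G` is `e^X` with `X ∈ 𝐠 = (unitarySubgroupLogChart G hG).lie`; the exponential chart `Θ_G : 𝐠 → G` is onto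

statement-level skeleton of published theorems with citation tags; proofs where landed; nothing here is a claim
about the Yang–Mills mass gap

Mega-formalization `lit-balaban` (HOME `run/shared/lean/pub/lit-balaban/`), unit `lit-balaban-p28` gen 16 (Phase-2
proof seat; free-target protocol G.5-34(d), TAKING 2026-08-23T11:03Z).  File 2 of 5 of the target «[Helgason2000]
Thm. 1.14 (13) / [Balaban1985UV3] p. 260 GLOBALLY for `SO(N)` and `Sp(n)`»: the global statements need, for each group
element `g`, ONE Lie-algebra element `X` with `e^X = g⁻¹` (the point at which the real-analytic function
`X ↦ det(1 + g e^X)` of file 3 `HaarNegOneEigenvalueNull` does not vanish).  Print ([Balaban1987RG1] §0 pp. 251–252)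
reads the gauge group as «a compact Lie group G … a Lie subgroup of a group of complex unitary matrices, for example
G ⊂ U(N)»; the tree carries such `G` as closed subgroups `G ≤ U(N)` with gen 8's log chart `unitarySubgroupLogChart G hG`
(Lie algebra `𝐠 = {X | e^{tX} ∈ G ∀ t}`) and gen 10's exponential chart `Θ_G = (isChartRep_unitarySubgroup G hG).expChart`.
THIS FILE is a BRIDGE BY NAME: the tree's `Literature.RepresentationTheory.CompactGroups.MatrixLie.exists_exp_eq`
(file `MatrixGroupExpSurjective`, an elementary proof of IV (2.2) for connected closed unitary matrix groups
`S ⊆ M_N(ℂ)`, Lie algebra `MatrixLie.lieAlg = {X | e^{tX} ∈ S ∀ t}`) is read on `S = G ⊂ M_N(ℂ)`; the two Lie algebras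
coincide by `Iff.rfl`.  SKELETON rows served (SUPPORT cells only, no head change): B12.Def§0 (owner r09/r20; «G compact
… Lie subgroup of U(N)»), B10.Eq21 / E18 (r07), B13.Eq1.37 (r10).

CITATION HEADER.  [BrockerTomDieck1985] Th. Bröcker, T. tom Dieck, *Representations of Compact Lie Groups*, GTM 98,
Springer (1985) (held `book:brockernd-representations-compact-lie-groups`), Ch. IV **(2.2) Theorem** *«Let G be a compact
connected Lie group. The exponential map exp: LG → G is surjective.»* (printed proof: corollary of the main theorem on
maximal tori IV (1.6); the tree's `MatrixGroupExpSurjective` proves it for closed connected `S ⊆ U(N)` by induction on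
`dim L(S)` with Hunt's lemma and a submersion lemma).  [Hall2015] B. C. Hall, *Lie Groups, Lie Algebras, and
Representations*, GTM 222, Def. 3.18 / Cor. 3.44 (the Lie algebra `{X | e^{tX} ∈ G ∀ t}` of a matrix Lie group).
[Balaban1987RG1] T. Bałaban, CMP **109** (1987) §0 pp. 251–252 (the setting `G ⊂ U(N)`, `𝐠`).

WHAT IS PROVED (theorems only; 0 definitions, 0 named facts, 0 sorry; axioms standard).  `Gs ≤ U(N)` closed (`hG`),
`𝐠 = (unitarySubgroupLogChart Gs hG).lie`, `Θ = (isChartRep_unitarySubgroup Gs hG).expChart`.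
* §1 `isClosedUnitaryGroup_image_val` (`G ⊂ M_N(ℂ)` is a `MatrixLie.IsClosedUnitaryGroup`), `mem_lieAlg_iff` /
  **`lieAlg_eq_lie`: `MatrixLie.lieAlg = 𝐠`** (`Iff.rfl`), `isPreconnected_image_val` (connectedness read in `M_N(ℂ)`).
* §2 **`exists_mem_lie_exp_eq`: for CONNECTED closed `G ≤ U(N)`, every `u ∈ G` is `e^X` with `X ∈ 𝐠`**;
  `exp_image_lie_eq` (`exp 𝐠 = G` in `M_N(ℂ)`); **`expChart_surjective`** (`Θ_G : 𝐠 → G` onto), `range_expChart_eq_univ`,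
  `exists_expChart_eq_inv` (`∃ X ∈ 𝐠`-chart with `Θ X = g⁻¹`, the form used by file 3).

HONEST SCOPE.  (i) Pure bridge; the mathematics is `MatrixLie.exists_exp_eq` (tree) — nothing re-proved.  (ii)
Connectedness is a hypothesis (`IsConnected (G : Set U(N))`, the form of `B12LieCentreClosedSubgroup`); it is necessary
(`O(N)`, finite `G`).  (iii) No norm enters the statements (`exp`, `𝐠` are norm-free).
-/

noncomputable section

open NormedSpace Set Function Topology
open scoped Matrix.Norms.L2Operator

namespace Literature.MathematicalPhysics.QuantumFieldTheory.Balaban1983to89.ExpSurjectiveConnectedSubgroup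

open HaarExponentialChart HaarExponentialChart.IsChartRep
open LogChartClosedSubgroup (unitarySubgroupLogChart mem_unitarySubgroupLogChart_lie_iff isClosed_image_val_of_isClosed)
open Literature.RepresentationTheory.CompactGroups (MatrixLie.IsClosedUnitaryGroup MatrixLie.lieAlg MatrixLie.mem_lieAlg
  MatrixLie.exists_exp_eq)
open Literature.MathematicalPhysics.QuantumLattice (unitaryFundamentalRep unitaryFundamentalRep_apply)

variable {n : Type*} [Fintype n] [DecidableEq n]
variable (Gs : Subgroup (Matrix.unitaryGroup n ℂ)) (hG : IsClosed (Gs : Set (Matrix.unitaryGroup n ℂ)))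

/-! ## §1 `G ⊂ M_N(ℂ)` is a closed unitary matrix group whose `MatrixLie` Lie algebra is the chart's `𝐠` -/

/-- **`G ≤ U(N)` read in `M_N(ℂ)` is a closed unitary matrix group** in the sense of the tree's
`MatrixLie.IsClosedUnitaryGroup` (contains `1`, closed under products and `ᴴ`, unitary, closed).
[cite: BrockerTomDieck1985, I (3.11)] [cite: Balaban1987RG1, §0 pp.251–252] -/
theorem isClosedUnitaryGroup_image_val (hG : IsClosed (Gs : Set (Matrix.unitaryGroup n ℂ))) :
    MatrixLie.IsClosedUnitaryGroup (Subtype.val '' (Gs : Set (Matrix.unitaryGroup n ℂ)) : Set (Matrix n n ℂ)) where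
  one_mem := ⟨1, Gs.one_mem, rfl⟩
  mul_mem := by
    rintro _ _ ⟨a, ha, rfl⟩ ⟨b, hb, rfl⟩
    exact ⟨a * b, Gs.mul_mem ha hb, rfl⟩
  star_mem := by
    rintro _ ⟨a, ha, rfl⟩
    refine ⟨a⁻¹, Gs.inv_mem ha, ?_⟩
    rw [Matrix.UnitaryGroup.inv_val, Matrix.star_eq_conjTranspose]
  mem_unitary := by
    rintro _ ⟨a, _, rfl⟩
    exact a.2
  isClosed := isClosed_image_val_of_isClosed hG

/-- The two Lie algebras agree elementwise: `X ∈ MatrixLie.lieAlg ⟺ X ∈ 𝐠` (both say `e^{tX} ∈ G ∀ t ∈ ℝ`).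
[cite: Hall2015, Def. 3.18, Cor. 3.44] -/
theorem mem_lieAlg_iff (X : Matrix n n ℂ) :
    X ∈ MatrixLie.lieAlg (isClosedUnitaryGroup_image_val Gs hG) ↔ X ∈ (unitarySubgroupLogChart Gs hG).lie := by
  rw [MatrixLie.mem_lieAlg, mem_unitarySubgroupLogChart_lie_iff]

/-- **`MatrixLie.lieAlg (G ⊂ M_N(ℂ)) = 𝐠`**, the log-chart Lie algebra of gen 8. [cite: Hall2015, Def. 3.18, Cor. 3.44] -/
theorem lieAlg_eq_lie :
    MatrixLie.lieAlg (isClosedUnitaryGroup_image_val Gs hG) = (unitarySubgroupLogChart Gs hG).lie :=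
  SetLike.ext fun X => mem_lieAlg_iff Gs hG X

omit hG in
/-- Connectedness of `G ≤ U(N)` read in `M_N(ℂ)`. [cite: BrockerTomDieck1985, IV (2.2)] -/
theorem isPreconnected_image_val (hconn : IsConnected (Gs : Set (Matrix.unitaryGroup n ℂ))) :
    IsPreconnected (Subtype.val '' (Gs : Set (Matrix.unitaryGroup n ℂ)) : Set (Matrix n n ℂ)) :=
  (hconn.image _ continuous_subtype_val.continuousOn).isPreconnected

/-- `IsConnected (G : Set U(N))` from `ConnectedSpace G`. [cite: BrockerTomDieck1985, IV (2.2)] -/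
theorem isConnected_coe_of_connectedSpace [ConnectedSpace Gs] :
    IsConnected (Gs : Set (Matrix.unitaryGroup n ℂ)) :=
  isConnected_iff_connectedSpace.2 ‹_›

/-! ## §2 [BrockerTomDieck1985] IV (2.2) for every closed connected `G ≤ U(N)` -/

/-- **[BtD] IV (2.2) «exp: LG → G is surjective» FOR EVERY CLOSED CONNECTED `G ≤ U(N)`**: every `u ∈ G` is `e^X` for
some `X ∈ 𝐠` (the tree's `MatrixLie.exists_exp_eq` read on `G ⊂ M_N(ℂ)`). [cite: BrockerTomDieck1985, IV (2.2)] -/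
theorem exists_mem_lie_exp_eq (hconn : IsConnected (Gs : Set (Matrix.unitaryGroup n ℂ)))
    {u : Matrix.unitaryGroup n ℂ} (hu : u ∈ Gs) :
    ∃ X ∈ (unitarySubgroupLogChart Gs hG).lie, exp X = (u : Matrix n n ℂ) := by
  obtain ⟨X, hX, hXu⟩ := MatrixLie.exists_exp_eq (isClosedUnitaryGroup_image_val Gs hG)
    (isPreconnected_image_val Gs hconn) ⟨u, hu, rfl⟩
  exact ⟨X, (mem_lieAlg_iff Gs hG X).1 hX, hXu⟩

/-- **`exp 𝐠 = G`** (as subsets of `M_N(ℂ)`) for closed connected `G ≤ U(N)`. [cite: BrockerTomDieck1985, IV (2.2)] -/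
theorem exp_image_lie_eq (hconn : IsConnected (Gs : Set (Matrix.unitaryGroup n ℂ))) :
    (fun X : Matrix n n ℂ => exp X) '' ((unitarySubgroupLogChart Gs hG).lie : Set (Matrix n n ℂ)) =
      Subtype.val '' (Gs : Set (Matrix.unitaryGroup n ℂ)) := by
  apply Subset.antisymm
  · rintro _ ⟨X, hX, rfl⟩
    exact (unitarySubgroupLogChart Gs hG).exp_mem hX
  · rintro _ ⟨u, hu, rfl⟩
    obtain ⟨X, hX, hXu⟩ := exists_mem_lie_exp_eq Gs hG hconn hu
    exact ⟨X, hX, hXu⟩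

/-- **THE EXPONENTIAL CHART `Θ_G : 𝐠 → G` IS ONTO** for closed connected `G ≤ U(N)`.
[cite: BrockerTomDieck1985, IV (2.2)] [cite: Helgason2000, Ch. I §1 Thm. 1.14 (13) p. 96] -/
theorem expChart_surjective (hconn : IsConnected (Gs : Set (Matrix.unitaryGroup n ℂ))) :
    Function.Surjective (isChartRep_unitarySubgroup Gs hG).expChart := by
  intro g
  obtain ⟨X, hX, hXg⟩ := exists_mem_lie_exp_eq Gs hG hconn g.2
  refine ⟨⟨X, hX⟩, (isChartRep_unitarySubgroup Gs hG).injective ?_⟩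
  rw [rho_expChart]
  exact hXg

/-- `range Θ_G = G`. [cite: BrockerTomDieck1985, IV (2.2)] -/
theorem range_expChart_eq_univ (hconn : IsConnected (Gs : Set (Matrix.unitaryGroup n ℂ))) :
    Set.range (isChartRep_unitarySubgroup Gs hG).expChart = Set.univ :=
  (expChart_surjective Gs hG hconn).range_eq

/-- The form used downstream: for every `g ∈ G` some chart element `X` has `Θ_G X = g⁻¹`, i.e. `ρ(g) · e^X = 1`.
[cite: BrockerTomDieck1985, IV (2.2)] -/
theorem exists_expChart_eq_inv (hconn : IsConnected (Gs : Set (Matrix.unitaryGroup n ℂ))) (g : Gs) :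
    ∃ X : (unitarySubgroupLogChart Gs hG).lie,
      (isChartRep_unitarySubgroup Gs hG).expChart X = g⁻¹ ∧
        (((g : Gs) : Matrix.unitaryGroup n ℂ) : Matrix n n ℂ) * exp (X : Matrix n n ℂ) = 1 := by
  obtain ⟨X, hX⟩ := expChart_surjective Gs hG hconn g⁻¹
  refine ⟨X, hX, ?_⟩
  have h1 : exp (X : Matrix n n ℂ) = (((g⁻¹ : Gs) : Matrix.unitaryGroup n ℂ) : Matrix n n ℂ) := by
    rw [← hX, ← rho_expChart (isChartRep_unitarySubgroup Gs hG) X]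
    rfl
  rw [h1]
  have h2 : ((((g : Gs) * g⁻¹ : Gs) : Matrix.unitaryGroup n ℂ) : Matrix n n ℂ) = 1 := by
    rw [mul_inv_cancel]; rfl
  simpa only [Subgroup.coe_mul, Submonoid.coe_mul] using h2

end Literature.MathematicalPhysics.QuantumFieldTheory.Balaban1983to89.ExpSurjectiveConnectedSubgroup

end
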